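import Literature.Barriers.ValiantsHypothesis.BDGIL24BorderNullstellensatz
import Literature.Barriers.ValiantsHypothesis.BDGIL24NaturalProofsMainTheoremProofs
import HarnessLib

/-!
# van den Berg–Dutta–Gesmundo–Ikenmeyer–Lysikov 2024, §2.4: the border class of an invariant
# measure — `c̲` is invariant, `I(C̄) = I(C)`, and Thm. 2.4 for `C̄` — PROVED

Theorem-only companion of `BDGIL24BorderNullstellensatz.lean` (border measure `c̲ =
borderMeasure c`, Zariski rendering) and `BDGIL24NaturalProofsMainTheoremProofs.lean`
(`thm_2_4_holds`), val-lit row vdBDGIL24-A. The paper (§2.4, p.8): "a complexity class `C`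
defined in terms of the growth of a given complexity measure naturally induces a border
complexity class `C̄`, described by the growth of the corresponding border complexity measure"
and "lower bounds achieved via metapolynomials are better described in the setting of border
complexity". In the tree's vocabulary this file records, with proofs:

* `linSubstRep_mem_metaClosure_slice` — the metapolynomial closure `\overline{X_{d,r}}` of a
  slice of an INVARIANT measure is `GL_k`-stable (`Δ(g·f) = (g⁻¹·Δ)(f)`,
  `eval_formCoeff_linSubstRep`, and `g⁻¹·Δ` is again an equation of `X_{d,r}`);
* `isInvariantMeasure_borderMeasure` — hence `c̲` is an invariant measure;
* `forall_slice_borderMeasure_iff`, `vanishingIdealSeq_borderMeasure` — a metapolynomial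
  vanishes on `X̲_{d,r} = {c̲ ≤ r}` iff it vanishes on `X_{d,r}`, so `I(C̄) = I(C)` (for any `c`);
* `hasAlgebraicNaturalProofs_borderMeasure_iff` — natural proofs against `C̄` = natural proofs
  against `C`;
* `thm_2_4_borderMeasure` — Thm. 2.4 for the border class of an invariant measure.

No definitions, no new facts (net debt 0). Honest framing: bookkeeping consequences of §2.4 in
the Zariski rendering of `c̲` (disclosed in `BDGIL24BorderNullstellensatz.lean`); nothing here
bears on `VP ≠ VNP`, which is NOT proved.

## References
* [BergEtAl2024] arXiv:2411.03444, §2.3 (the `GL_k`-action on metapolynomials, p.7), §2.4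
  (border complexity, p.8–9), Def. 2.3 / Thm. 2.4 (p.10); held text `paper:arxiv-2411.03444`
  p0008–p0011.

## Mathlib and tree
Tree: `BDGIL24BorderNullstellensatz` (`metaClosure`, `borderMeasure`, `borderMeasure_le`,
`mem_metaClosure_slice_borderMeasure`, `metaClosure_mono`, `slice_mono`),
`BDGIL24NaturalProofsMainTheoremProofs` (`thm_2_4_holds`, `linSubstRep_mem_slice`),
`OrbitCoordinateRing` (`aeval_formCoeff_coordSubst`, `coordRep`), `LinSubst`
(`linSubstRep_apply`, `linSubst_isHomogeneous`).
-/

noncomputable section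

open MvPolynomial
open Literature.Computability.AlgebraicComplexity Literature.NumberTheory.DiophantineGeometry

namespace Literature.Barriers.ValiantsHypothesis

namespace BergEtAl2024

/-! ### The closure of a `GL`-stable slice is `GL`-stable; `c̲` is invariant -/

section Invariance

/-- `(g · Δ)(f) = Δ(g⁻¹ · f)` read backwards: `Δ(g · f) = (g⁻¹ · Δ)(f)`.
[cite: BergEtAl2024, §2.3 ("`GL_k` acts on the space of metapolynomials"), p.7 (PDF p.8)] -/
theorem eval_formCoeff_linSubstRep {k d : ℕ} (g : GL (Fin k) ℂ) (f : MvPolynomial (Fin k) ℂ)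
    (Δ : MvPolynomial (DegIdx (Fin k) d) ℂ) :
    eval (formCoeff d (linSubstRep (Fin k) ℂ g f)) Δ =
      eval (formCoeff d f) (coordRep (Fin k) ℂ d g⁻¹ Δ) := by
  have h : eval (formCoeff d f) (coordRep (Fin k) ℂ d g⁻¹ Δ) =
      eval (formCoeff d (linSubstRep (Fin k) ℂ g⁻¹⁻¹ f)) Δ :=
    aeval_formCoeff_coordSubst d g⁻¹ f Δ
  rw [h, inv_inv]

/-- **The metapolynomial closure of a slice of an invariant measure is `GL`-stable** ("`X_r` is
invariant under the action of `GL_k`" passes to the closure: if every equation of `X_{d,r}` kills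
`f`, every equation kills `g · f`, because `g⁻¹ · Δ` is again an equation of `X_{d,r}`).
[cite: BergEtAl2024, §2.2–§2.4, p.7–9 (PDF p.8–10)] -/
theorem linSubstRep_mem_metaClosure_slice {c : (k d : ℕ) → MvPolynomial (Fin k) ℂ → ℕ}
    (hc : IsInvariantMeasure c) {k d r : ℕ} {f : MvPolynomial (Fin k) ℂ}
    (hf : f ∈ metaClosure k d (slice c k d r)) (g : GL (Fin k) ℂ) :
    linSubstRep (Fin k) ℂ g f ∈ metaClosure k d (slice c k d r) := by
  intro Δ hΔ
  rw [eval_formCoeff_linSubstRep]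
  refine hf _ fun s hs => ?_
  have h : eval (formCoeff d s) (coordRep (Fin k) ℂ d g⁻¹ Δ) =
      eval (formCoeff d (linSubstRep (Fin k) ℂ g⁻¹⁻¹ s)) Δ :=
    aeval_formCoeff_coordSubst d g⁻¹ s Δ
  rw [h, inv_inv]
  exact hΔ _ (linSubstRep_mem_slice hc hs g)

/-- `c̲(g · f) ≤ c̲(f)` for a form `f` and an invariant `c`.
[cite: BergEtAl2024, §2.4, p.8–9 (PDF p.9–10)] -/
theorem borderMeasure_linSubstRep_le {c : (k d : ℕ) → MvPolynomial (Fin k) ℂ → ℕ}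
    (hc : IsInvariantMeasure c) {k d : ℕ} {f : MvPolynomial (Fin k) ℂ} (hf : f.IsHomogeneous d)
    (g : GL (Fin k) ℂ) :
    borderMeasure c k d (linSubstRep (Fin k) ℂ g f) ≤ borderMeasure c k d f :=
  Nat.sInf_le (linSubstRep_mem_metaClosure_slice hc (mem_metaClosure_slice_borderMeasure c hf) g)

/-- **The border measure of an invariant measure is invariant**: `c̲(g · f) = c̲(f)` for forms
`f` — so the border class `C̄` is again cut out by an invariant measure and Thm. 2.4 applies to it
(`thm_2_4_holds (borderMeasure c)`). [cite: BergEtAl2024, §2.4, p.8–9 (PDF p.9–10)] -/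
theorem isInvariantMeasure_borderMeasure {c : (k d : ℕ) → MvPolynomial (Fin k) ℂ → ℕ}
    (hc : IsInvariantMeasure c) : IsInvariantMeasure (borderMeasure c) := by
  intro k d g f hf
  refine le_antisymm (borderMeasure_linSubstRep_le hc hf g) ?_
  have hgf : (linSubstRep (Fin k) ℂ g f).IsHomogeneous d := by
    rw [linSubstRep_apply]
    exact linSubst_isHomogeneous _ hf
  have h := borderMeasure_linSubstRep_le hc hgf g⁻¹
  rwa [← Module.End.mul_apply, ← map_mul, inv_mul_cancel, map_one, Module.End.one_apply] at h

/-- The slices of `c̲` lie in the closures of the slices of `c`: `X̲_{d,r} ⊆ \overline{X_{d,r}}`.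
[cite: BergEtAl2024, §2.4, p.8–9 (PDF p.9–10)] -/
theorem slice_borderMeasure_subset_metaClosure (c : (k d : ℕ) → MvPolynomial (Fin k) ℂ → ℕ)
    (k d r : ℕ) : slice (borderMeasure c) k d r ⊆ metaClosure k d (slice c k d r) :=
  fun _ hf =>
    metaClosure_mono k d (slice_mono c k d hf.2) (mem_metaClosure_slice_borderMeasure c hf.1)

/-- `X_{d,r} ⊆ X̲_{d,r}` (`c̲ ≤ c` on forms). [cite: BergEtAl2024, §2.4, p.8–9 (PDF p.9–10)] -/
theorem slice_subset_slice_borderMeasure (c : (k d : ℕ) → MvPolynomial (Fin k) ℂ → ℕ)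
    (k d r : ℕ) : slice c k d r ⊆ slice (borderMeasure c) k d r :=
  fun _ hf => ⟨hf.1, (borderMeasure_le c hf.1).trans hf.2⟩

/-- A metapolynomial vanishes on `X̲_{d,r}` iff it vanishes on `X_{d,r}`.
("lower bounds achieved via metapolynomials are better described in the setting of border
complexity", §2.4). [cite: BergEtAl2024, §2.4, p.8 (PDF p.9)] -/
theorem forall_slice_borderMeasure_iff (c : (k d : ℕ) → MvPolynomial (Fin k) ℂ → ℕ) (k d r : ℕ)
    (Δ : MvPolynomial (DegIdx (Fin k) d) ℂ) :
    (∀ f ∈ slice (borderMeasure c) k d r, eval (formCoeff d f) Δ = 0) ↔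
      ∀ f ∈ slice c k d r, eval (formCoeff d f) Δ = 0 :=
  ⟨fun h f hf => h f (slice_subset_slice_borderMeasure c k d r hf),
    fun h _ hf => slice_borderMeasure_subset_metaClosure c k d r hf Δ h⟩

/-- **`I(C̄) = I(C)`**: the equations of the border class are the equations of the class.
[cite: BergEtAl2024, §2.4–§2.5, p.8–10 (PDF p.9–11)] -/
theorem vanishingIdealSeq_borderMeasure (c : (k d : ℕ) → MvPolynomial (Fin k) ℂ → ℕ)
    (kk : ℕ → ℕ) : vanishingIdealSeq (borderMeasure c) kk = vanishingIdealSeq c kk := by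
  ext Δ
  simp only [vanishingIdealSeq, Set.mem_setOf_eq, forall_slice_borderMeasure_iff]

/-- **Natural proofs against `C̄` are natural proofs against `C`** (and conversely).
[cite: BergEtAl2024, Def. 2.3 and §2.4, p.8–10 (PDF p.9–11)] -/
theorem hasAlgebraicNaturalProofs_borderMeasure_iff (c : (k d : ℕ) → MvPolynomial (Fin k) ℂ → ℕ) :
    HasAlgebraicNaturalProofs (borderMeasure c) ↔ HasAlgebraicNaturalProofs c := by
  simp only [HasAlgebraicNaturalProofs, vanishingIdealSeq_borderMeasure]

/-- **Thm. 2.4 for the border class**: for an invariant `c`, `C̄` (cut out by the invariant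
measure `c̲`) has algebraic natural proofs iff `I(C̄) ∩ metaVQP ∩ Isotypic` — equivalently
`I(C) ∩ metaVQP ∩ Isotypic` — contains a sequence that is not eventually zero.
[cite: BergEtAl2024, Thm. 2.4 with §2.4, p.8–10 (PDF p.9–11)] -/
theorem thm_2_4_borderMeasure {c : (k d : ℕ) → MvPolynomial (Fin k) ℂ → ℕ}
    (hc : IsInvariantMeasure c) :
    HasAlgebraicNaturalProofs (borderMeasure c) ↔
      ∃ (kk : ℕ → ℕ) (Δ : (n : ℕ) → MvPolynomial (DegIdx (Fin (kk n)) n) ℂ),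
        Δ ∈ vanishingIdealSeq c kk ∧ Δ ∈ metaVQP kk ∧ (∀ n, IsIsotypic (Δ n)) ∧
          ¬ EventuallyZero Δ := by
  rw [hasAlgebraicNaturalProofs_borderMeasure_iff]
  exact thm_2_4_holds c hc

end Invariance

end BergEtAl2024

end Literature.Barriers.ValiantsHypothesis

end
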